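/-
Copyright (c) 2026 the pub-hodgecm-mathlib formalisation cell (harness21).  Prover seat hodgecm-mathlib-K2Liu-p09 (g6): Track B «K2-LIT»,
hLiu418 = stmt-HodgeConjecture-24832; LEAD F0P6-plan RULING M-158d «A7-val road (σ)», file V7b (the value at `½` on big-cell sections, `n = 2`).
-/
import Summits.HodgeConjecture.HodgeConjecture.Theorems.K2LiuA7ValueBigCell      -- ★ V7a p860184 `localIntertwining_flat_eq_finset_sum` (brings ★ V1 `value_unique`, `aNorm_two_ne_zero`)
import Summits.HodgeConjecture.HodgeConjecture.Theorems.K2LiuQRationalLFactor    -- ★ A7-reg (a): `isQRationalRegularAt_lF_affine ∕ _lEN_affine`, `lF_ne_zero`, `comp_affine`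
import HarnessLib

/-!
# Crux `HLiu418`, road `K2_Liu`, organ A7-val, file V7b: THE VALUE AT `½` ON BIG-CELL SECTIONS (`n = 2`): `Fn(½)(1) = Λ(φ) · a_v(½)⁻¹`

Cell `hodgecm-mathlib`, crux item hLiu418 = `stmt-HodgeConjecture-24832`; squad K2 ∕ K2Liu; prover K2Liu-p09 (g6), organ lead A7-val.  THEOREMS ONLY; lane
`--supports stmt-HodgeConjecture-24832` (count-neutral helper).  Frame-free generic D10 currency at `n = 2` (the curve case `H_v = U(2,2)`), every finite place.
* `isQRationalRegularAt_inv_aNorm_two` — `s ↦ aNorm(s)⁻¹ = vol⁻¹ · b_2(s)∕a_2(s)` is `q_v`-rational and REGULAR AT `½` at EVERY place (unitary `χ_v`): the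
  factor `L_F(2s−1, χ_F)⁻¹ = 1 − χ_F(ϖ) q_v^{1−2s}` is a polynomial; the others are regular and non-zero at `½` (★ A7-reg (a)).
* **`value_bigCell_two`** — for a `K₀`-flat family `f` of Siegel sections of `I_v(s, χ_v)` whose member `f(½)` is smooth and BIG-CELL AT `1`, EVERY admissible
  (A4′-R) datum at `h = 1` (`M_v(s)(f s)(1) = aNorm(s) · Fn s 1` on `1 < re s`, `Fn(·) 1` regular at `½`) has **`Fn(½) 1 = Λ(f(½)) · aNorm(½)⁻¹`**,
  `Λ(φ) = ∫_{N_Δ} φ(w_Δ u) dνN` (📤 V7a finite Laurent sum + ★ V1 `value_unique`).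
* `aNorm_two_half_ne_zero` ∕ `aNorm_two_half_eq_zero` — `aNorm(½) ≠ 0` iff `χ_F(ϖ_v) ≠ 1` (`unramValue (chiF χ_v) ≠ 1`: every NON-SPLIT `v`, where
  `χ_F = ε_{E∕F}` or is ramified); at a split `v` (`χ_F = 1` unramified, `unramValue = 1`) `aNorm(½) = 0` in Lean's conventions (the pole of `ζ_{F_v}(2s − 1)`) and
  big-cell sections are KILLED by the value functional — the V7 witness there must come from the closed cell.
* `value_bigCell_two_ne_zero` — hence **`Fn(½) 1 ≠ 0` whenever `Λ(f(½)) ≠ 0` and `unramValue (chiF χ_v) ≠ 1`**: the binder `hne` of ★ V8e `face_two_of_laws` at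
  every non-split place, from the S1 organ's big-cell witness `F ∈ R₂(V′_v)` with `Λ(F) ≠ 0` (F7r, K2Liu-p07).
HONEST LABEL.  `HC_CM` is proved only modulo the 7 printed citations (2 remaining named inputs: hLiu418 = `stmt-HodgeConjecture-24832`,
h413 = `stmt-HodgeConjecture-24833`) until rung 0 closes.

## References
* [KudlaSweet1997] S. Kudla, W. J. Sweet, Israel J. Math. 98 (1997), §1 (`M(s)` on big-cell sections, the normalised value).
* [HarrisKudlaSweet1996] M. Harris, S. Kudla, W. J. Sweet, J. AMS 9 (1996), §6 (6.14)–(6.16) (`a_n`, `b_n`).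
* [Casselman1980] W. Casselman, Compositio Math. 40 (1980), §3.
-/

set_option autoImplicit false
set_option linter.dupNamespace false -- the mandated namespace repeats `HodgeConjecture.HodgeConjecture`

noncomputable section

open scoped Classical NNReal ENNReal
open NumberField IsDedekindDomain MeasureTheory Topology Set Filter
open Literature.NumberTheory.GaloisRepresentations Literature.NumberTheory.GaloisRepresentations.IsNonarchimedeanLocalField
open Literature.NumberTheory.Automorphic Literature.NumberTheory.Automorphic.UnitaryGroup
open Literature.NumberTheory.GelbartRogawski1991.UnitaryDualPair.LocalSplitting
open Literature.NumberTheory.K2Lit.LocalSiegelDoubled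
open Summit.HodgeConjecture.HodgeConjecture.Cruxes.HLiu418.K2LiuQRationalDefs
open Summit.HodgeConjecture.HodgeConjecture.Cruxes.HLiu418.K2LiuQRationalLFactor
open Summit.HodgeConjecture.HodgeConjecture.Cruxes.HLiu418.K2LiuLocalLFactorDefs
open Summit.HodgeConjecture.HodgeConjecture.Cruxes.HLiu418.K2LiuLocalSiegel
open Summit.HodgeConjecture.HodgeConjecture.Cruxes.HLiu418.K2LiuLocalIntertwiningProperty
open Summit.HodgeConjecture.HodgeConjecture.Cruxes.HLiu418.K2LiuFlatSiegelFamilies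
open Summit.HodgeConjecture.HodgeConjecture.Cruxes.HLiu418.K2LiuA7ValueFunctional
open Summit.HodgeConjecture.HodgeConjecture.Cruxes.HLiu418.K2LiuA7ValueBigCell

namespace Summit.HodgeConjecture.HodgeConjecture.Cruxes.HLiu418.K2LiuA7ValueBigCellTwo

variable (F : Type) [Field F] [NumberField F] (E : Type) [Field E] [NumberField E] [Algebra F E]
  [Algebra.IsQuadraticExtension F E] (c : E ≃ₐ[F] E)
  {δ : E} (hcδ : c δ = -δ) (hδ : δ ≠ 0) {d : F} (hd : δ * δ = algebraMap F E d) (v : HeightOneSpectrum (𝓞 F))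
  {T₀ : Matrix (Fin 2) (Fin 2) F} (hT₀ : T₀.IsSymm) {JD : Matrix (Fin (2 + 2)) (Fin (2 + 2)) E} (hJD : JD = (gramD F 2 T₀).map (algebraMap F E))
  {χv : ∀ w : PlacesOver E v, (w.1.adicCompletion E)ˣ →* ℂˣ} (hχ : ∀ (w : PlacesOver E v) (x : (w.1.adicCompletion E)ˣ), ‖((χv w x : ℂˣ) : ℂ)‖ = 1)
  {vol : ℝ} (hvol : vol ≠ 0)

/-! ## §1 `aNorm⁻¹` is regular at `½`; the value of `aNorm` at `½` -/

section Normaliser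

omit [Algebra.IsQuadraticExtension F E] in
include hχ in
/-- **`s ↦ aNorm(s)⁻¹` IS REGULAR AT `½`** (`n = 2`, unitary `χ_v`, any `vol`): `aNorm(s)⁻¹ = vol⁻¹ · L_F(2s+2) · (L_{E∕F}(2s+1)∕L_F(2s+1)) · (1 − χ_F(ϖ)q^{1−2s}) ·
L_F(2s) · L_{E∕F}(2s)⁻¹` — a product of functions regular at `½` (★ A7-reg (a)). [cite: HarrisKudlaSweet1996, §6 (6.16)] [cite: Casselman1980, §3] -/
theorem isQRationalRegularAt_inv_aNorm_two :
    IsQRationalRegularAt (residueFieldCard (v.adicCompletion F)) (1 / 2) fun s => (aNorm F E c v 2 χv vol s)⁻¹ := by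
  have hq : residueFieldCard (v.adicCompletion F) ≠ 0 := residueFieldCard_ne_zero _
  -- the polynomial factor `L_F(2s−1)⁻¹ = 1 − u q^{−(2s−1)}`
  have hpoly : IsQRationalRegularAt (residueFieldCard (v.adicCompletion F)) (1 / 2) fun s => (lF F E v χv (2 * s - 1))⁻¹ := by
    have h1 : IsQRationalRegularAt (residueFieldCard (v.adicCompletion F)) ((2 : ℕ) * (1 / 2 : ℂ) + (-1))
        fun z => 1 - unramValue F v (chiF F E v χv) * qVar (residueFieldCard (v.adicCompletion F)) z :=
      (isQRationalRegularAt_const _ _ 1).sub ((isQRationalRegularAt_qVar_zpow hq _ 1).const_mul _ |>.congr fun z => by rw [zpow_one])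
    have h2s : ∀ s : ℂ, 2 * s - 1 = ((2 : ℕ) : ℂ) * s + (-1) := fun s => by push_cast; ring
    refine (h1.comp_affine hq 2 (-1)).congr fun s => ?_
    show 1 - unramValue F v (chiF F E v χv) * qVar (residueFieldCard (v.adicCompletion F)) (((2 : ℕ) : ℂ) * s + (-1)) = (lF F E v χv (2 * s - 1))⁻¹
    rw [h2s s, lF, lFactor_def, inv_inv, qVar_def]
  -- the regular, non-vanishing factors
  have h2 : (0 : ℝ) < ((2 : ℕ) * (1 / 2 : ℂ) + 2).re := by norm_num
  have h1' : (0 : ℝ) < ((2 : ℕ) * (1 / 2 : ℂ) + 1).re := by norm_num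
  have h0 : (0 : ℝ) < ((2 : ℕ) * (1 / 2 : ℂ) + 0).re := by norm_num
  have hA := isQRationalRegularAt_lF_affine hχ 2 2 h2
  have hB := isQRationalRegularAt_lEN_affine c hχ 2 1 h1'
  have hC := (isQRationalRegularAt_lF_affine hχ 2 1 h1').inv (lF_ne_zero hχ h1')
  have hD := isQRationalRegularAt_lF_affine hχ 2 0 h0
  have hEN1 : lEN F E c v χv ((2 : ℕ) * (1 / 2 : ℂ) + 0) ≠ 0 := by
    unfold lEN
    exact Finset.prod_ne_zero_iff.2 fun w _ => lFactor_ne_zero (norm_unramValue_le_one (norm_chiNorm_eq_one hχ w)) h0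
  have hE' := (isQRationalRegularAt_lEN_affine c hχ 2 0 h0).inv hEN1
  refine (((((((isQRationalRegularAt_const _ _ ((vol : ℂ)⁻¹)).mul hA).mul hB).mul hC).mul hpoly).mul hD).mul hE').congr fun s => ?_
  rw [aNorm_two]
  push_cast
  simp only [mul_inv, div_eq_mul_inv, inv_inv, add_zero]
  ring

omit [Algebra.IsQuadraticExtension F E] in
include hχ hvol in
/-- **`aNorm(½) ≠ 0` WHEN `χ_F(ϖ_v) ≠ 1`** (`unramValue (chiF χ_v) ≠ 1`: every non-split place — `χ_F = ε_{E∕F,v}` inert gives `−1`, ramified `χ_F` gives `0`).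
[cite: HarrisKudlaSweet1996, §6 (6.16)] -/
theorem aNorm_two_half_ne_zero (hu : unramValue F v (chiF F E v χv) ≠ 1) : aNorm F E c v 2 χv vol (1 / 2) ≠ 0 := by
  have h3 : (0 : ℝ) < (2 * (1 / 2 : ℂ) + 2).re := by norm_num
  have h2 : (0 : ℝ) < (2 * (1 / 2 : ℂ) + 1).re := by norm_num
  have h1 : (0 : ℝ) < (2 * (1 / 2 : ℂ)).re := by norm_num
  have hEN : ∀ z : ℂ, 0 < z.re → lEN F E c v χv z ≠ 0 := fun z hz => by
    unfold lEN
    exact Finset.prod_ne_zero_iff.2 fun w _ => lFactor_ne_zero (norm_unramValue_le_one (norm_chiNorm_eq_one hχ w)) hz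
  have h0 : lF F E v χv (2 * (1 / 2 : ℂ) - 1) ≠ 0 := by
    rw [show (2 * (1 / 2 : ℂ) - 1) = 0 by norm_num, lF, lFactor_def, neg_zero, Complex.cpow_zero, mul_one]
    exact inv_ne_zero (sub_ne_zero.2 (Ne.symm hu))
  rw [aNorm_two]
  refine mul_ne_zero (Complex.ofReal_ne_zero.2 hvol) (div_ne_zero (mul_ne_zero h0 (div_ne_zero (hEN _ h1) (lF_ne_zero hχ h1)))
    (mul_ne_zero (lF_ne_zero hχ h3) (div_ne_zero (hEN _ h2) (lF_ne_zero hχ h2))))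

omit [Algebra.IsQuadraticExtension F E] in
/-- **`aNorm(½) = 0` WHEN `χ_F(ϖ_v) = 1`** (every place split in `E` with `χ_F` unramified): the pole of `L_F(2s − 1, χ_F) = ζ_{F_v}(2s−1)` at `½`, in Lean's
convention `0⁻¹ = 0` — big-cell sections are killed by the value functional there. [cite: HarrisKudlaSweet1996, §6 (6.16)] [cite: KudlaSweet1997, §1] -/
theorem aNorm_two_half_eq_zero (hu : unramValue F v (chiF F E v χv) = 1) : aNorm F E c v 2 χv vol (1 / 2) = 0 := by
  have h0 : lF F E v χv (2 * (1 / 2 : ℂ) - 1) = 0 := by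
    rw [show (2 * (1 / 2 : ℂ) - 1) = 0 by norm_num, lF, lFactor_def, neg_zero, Complex.cpow_zero, mul_one, hu, sub_self, inv_zero]
  rw [aNorm_two, h0, zero_mul, zero_div, mul_zero]

end Normaliser

/-! ## §2 The value at `½` on big-cell sections -/

section Value

variable (K₀ : Subgroup (UnitaryGroup.localPi E c (2 + 2) JD v))
  (hK₀ : IsCompact (K₀ : Set (UnitaryGroup.localPi E c (2 + 2) JD v)) ∧ IsOpen (K₀ : Set (UnitaryGroup.localPi E c (2 + 2) JD v)))
  (hIw : ∀ x : UnitaryGroup.localPi E c (2 + 2) JD v, ∃ p, IsSiegelDelta F E c hcδ hδ hd v 2 hT₀ hJD p ∧ ∃ k ∈ K₀, x = p * k)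
  [MeasurableSpace (unipDeltaLocal F E c v 2 (JD := JD))] [BorelSpace (unipDeltaLocal F E c v 2 (JD := JD))]
  (νN : Measure (unipDeltaLocal F E c v 2 (JD := JD))) [IsFiniteMeasureOnCompacts νN]
  {f : ℂ → UnitaryGroup.localPi E c (2 + 2) JD v → ℂ} (hSieg : ∀ s, IsLocalSiegelSection F E c hcδ hδ hd v 2 hT₀ hJD χv s (f s))
  (hflat : ∀ s s' : ℂ, ∀ k ∈ K₀, f s k = f s' k) (hsm : IsSmooth F E c v 2 (f (1 / 2)))
  (C : Set (unipDeltaLocal F E c v 2 (JD := JD))) (hC : IsCompact C)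
  (hsupp : ∀ u : unipDeltaLocal F E c v 2 (JD := JD), u ∉ C → f (1 / 2) (weylDelta F E c v 2 hJD * (u : UnitaryGroup.localPi E c (2 + 2) JD v)) = 0)
  {Fn : ℂ → UnitaryGroup.localPi E c (2 + 2) JD v → ℂ} (hFn_reg : IsQRationalRegularAt (residueFieldCard (v.adicCompletion F)) (1 / 2) fun s => Fn s 1)
  (hFn : ∀ s : ℂ, 1 < s.re → localIntertwining F E c v 2 hJD νN (f s) 1 = aNorm F E c v 2 χv vol s * Fn s 1)

include hcδ hδ hd hT₀ hJD hχ hvol hK₀ hIw hSieg hflat hsm hC hsupp hFn_reg hFn in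
/-- **THE VALUE AT `½` ON A BIG-CELL SECTION**: `Fn(½) 1 = Λ(f(½)) · aNorm(½)⁻¹`, `Λ(φ) = ∫_{N_Δ} φ(w_Δ u) dνN`, for every admissible (A4′-R) datum `Fn` at
`h = 1` of a `K₀`-flat family of Siegel sections whose member at `½` is smooth and big-cell at `1` (📤 V7a: `M_v(s)(f s)(1) = Σ_r r^{s−½} c_r`, `Σ c_r = Λ`; the
datum `Σ_r r^{s−½} c_r · aNorm(s)⁻¹` is admissible by §1; ★ V1 `value_unique`). [cite: KudlaSweet1997, §1] [cite: Casselman1980, §3] -/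
theorem value_bigCell_two :
    Fn (1 / 2) 1 = (∫ u, f (1 / 2) (weylDelta F E c v 2 hJD * (u : UnitaryGroup.localPi E c (2 + 2) JD v)) ∂νN) * (aNorm F E c v 2 χv vol (1 / 2))⁻¹ := by
  have hq : residueFieldCard (v.adicCompletion F) ≠ 0 := residueFieldCard_ne_zero _
  obtain ⟨R, cR, hR, hM, hΛ⟩ := localIntertwining_flat_eq_finset_sum F E c hcδ hδ hd v 2 hT₀ hJD χv K₀ hK₀ hIw νN hSieg hflat (1 / 2) hsm C hC hsupp
  have haN : ∀ s : ℂ, 1 < s.re → aNorm F E c v 2 χv vol s ≠ 0 := fun s hs => aNorm_two_ne_zero F E c v hχ hvol hs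
  -- the explicit admissible datum `P(s) · aNorm(s)⁻¹`
  have hP : IsQRationalRegularAt (residueFieldCard (v.adicCompletion F)) (1 / 2) fun s => ∑ r ∈ R, ((r : ℝ) : ℂ) ^ (s - 1 / 2) * cR r := by
    refine IsQRationalRegularAt.sum R fun r hr => ?_
    obtain ⟨K, hK⟩ := hR r hr
    refine ((isQRationalRegularAt_zpow_cpow_add hq K (-(1 / 2)) (1 / 2)).mul (isQRationalRegularAt_const _ _ (cR r))).congr fun s => ?_
    rw [hK, sub_eq_add_neg]
  have key := value_unique F E c v 2 hJD νN χv vol haN f Fn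
    (fun s _ => (∑ r ∈ R, ((r : ℝ) : ℂ) ^ (s - 1 / 2) * cR r) * (aNorm F E c v 2 χv vol s)⁻¹) 1 hFn_reg
    (hP.mul (isQRationalRegularAt_inv_aNorm_two F E c v hχ)) hFn
    (fun s hs => by rw [hM s, mul_comm, mul_assoc, inv_mul_cancel₀ (haN s hs), mul_one])
  rw [key, ← hΛ]
  congr 1
  exact Finset.sum_congr rfl fun r _ => by rw [sub_self, Complex.cpow_zero, one_mul]

include hcδ hδ hd hT₀ hJD hχ hvol hK₀ hIw hSieg hflat hsm hC hsupp hFn_reg hFn in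
/-- **THE V7 WITNESS CRITERION AT NON-SPLIT PLACES**: if `Λ(f(½)) ≠ 0` and `χ_F(ϖ_v) ≠ 1` then `Fn(½) 1 ≠ 0` — with the S1 organ's big-cell section `F = f^Δ_{Φ₀}
∈ R₂(V′_v)`, `Λ(F) ≠ 0` (F7r), this is the binder `hne` of ★ V8e `face_two_of_laws`. [cite: KudlaSweet1997, §1, Thm. 1.2] [cite: HarrisKudlaSweet1996, §6 (6.16)] -/
theorem value_bigCell_two_ne_zero
    (hΛ : (∫ u, f (1 / 2) (weylDelta F E c v 2 hJD * (u : UnitaryGroup.localPi E c (2 + 2) JD v)) ∂νN) ≠ 0)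
    (hu : unramValue F v (chiF F E v χv) ≠ 1) : Fn (1 / 2) 1 ≠ 0 := by
  rw [value_bigCell_two F E c hcδ hδ hd v hT₀ hJD hχ hvol K₀ hK₀ hIw νN hSieg hflat hsm C hC hsupp hFn_reg hFn]
  exact mul_ne_zero hΛ (inv_ne_zero (aNorm_two_half_ne_zero F E c v hχ hvol hu))

end Value

end Summit.HodgeConjecture.HodgeConjecture.Cruxes.HLiu418.K2LiuA7ValueBigCellTwo

end
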